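import Literature.Computability.Cryptography.ChenQuantumLWEReadoutAttained

/-!
# Chen 2024 (withdrawn), Step 8 → Step 9: the read-out bound of (S) is the value on the WHOLE CLASS

REPRODUCTION / ANALYSIS OF A CLAIMED RESULT UNDER ADJUDICATION — header required by the tree's literature
rule.  Author: Yilei Chen.  Title: *Quantum Algorithms for Lattice Problems*.  Venue: IACR Cryptology ePrint
Archive, Paper 2024/555, version of 18 April 2024 (the main claim WITHDRAWN by the author, title-page note;
the bug is in Step 9, p. 37). [ChenQuantumLattice2024]  Printed page numbers.

HONEST FRAMING (bundle `papers/QuantumAdvantage/lwe-quantum-autopsy/`, Part 1, generation 12): the value of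
this file is a kernel-checked THEOREM — the exact minimax value, over the whole instance class, of one
read-out problem about one step of a withdrawn algorithm — NOT summit progress and no cryptanalytic claim in
either direction (nothing here says LWE is quantumly easy or hard; no algorithm for LWE is proposed, repaired
or broken; the §3.5.9 bug stands).

THE QUESTION.  (S) `Shape.step9Needs_readout_le_dummies`: for every POVM `E` on the Step-8 register and every
decoder to `ℤ_{D²P}`, some instance of the class `InClass U` ("slopes `b_i`, `i ∈ U`, and the offset `v′`
unknown") reads out the Step-9 datum `v′₀ mod D²P` with weight at most `pairsCountT(Q,T)/Q^{2n}·⟨φ7.d|φ7.d⟩`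
whenever `T+1 ⊆ U`.  (T) `Shape.step9Needs_readout_attained` showed this constant is attained on the dummy
FAMILY `F_T` (one coset of offsets), and (T) SCOPE (a) left the value on the whole class open, remarking that
"the frames of different cosets are not mutually orthogonal and no single measurement of the present kind
serves them all".  THAT REMARK WAS WRONG, and this file proves the opposite: ONE measurement attains the
constant on EVERY instance of the class, so `pairsCountT(Q,T_U)/Q^{2n}` (`T_U := {t : t+1 ∈ U}`) is the
minimax value of the single-copy read-out problem on the whole class `InClass U`.

WHAT IS DONE HERE.  Fix an admissible shape `S`.
* **`Shape.wv_neg_two_mul_apply`** — Fourier inversion of (R) `phi7_inst_expansion` at zero tail slopes: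
  every frame vector is a combination of STATES, `w_{η,−2x} = ψ_Q(p₁x²)·Σ_{y∈ℤ_Qⁿ} ψ_Q(⟨η,y⟩)·|φ7(b⁰, v′+L(x,y))⟩`.
* **`Shape.star_wv_dotProduct_wv_inst`** — hence the frame of `S` is ORTHOGONAL to the frame of every
  instance `(b, v)` whose offset `v` is NOT congruent to `v′` modulo `L = 2D²p₁` (coordinatewise): each cross
  term is an overlap of two equal-slope states with offsets inequivalent modulo `M = LQ`, which vanishes by
  (Q) `dot_phi7_sameB` ((T)'s remark to the contrary was wrong; the general tool is the elementary
  `dotProduct_eq_zero_of_pointwise_sum`).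
* **`Shape.Coset`, `Shape.vrep`, `Shape.cshape`, `Shape.bigFrameVec`, `Shape.bigFrame_orth`** — the offsets
  of the class fall into `(2Dp₁)ⁿ⁺¹ = (L/D)ⁿ⁺¹` cosets `D·c + Lℤⁿ⁺¹`; the UNION over all cosets `c` of the
  transformed frames `(T w^{(c)}_{η,m})_{η,m}` of (T) is ONE orthogonal frame of common squared norm `ν`
  ((R) `dotProduct_step8Map`, `wv_support_D`).
* **`Shape.classPOVM`, `Shape.classDec`** — its frame POVM ((T) `POVM.ofFrame`) with a uniform dummy guess
  ((S) `POVM.withCoin`), decoded coset by coset with (T) `frameDec`.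
* **`Shape.step9Needs_readout_attained_cmember`** — on every member of every coset family the success
  weight is EXACTLY `pairsCountT(Q,T)/Q^{2n}·⟨φ7.d|φ7.d⟩` (the other cosets' outcomes have weight `0`,
  `bigFrameVec_dotProduct_cmember_ne`; within the coset it is (T)'s computation for the shape `cshape c`).
* **`Shape.exists_cmember_of_inClass`** — EVERY instance of `InClass U` has the same `|φ7.d⟩` AND the same
  Step-9 datum as a member of some coset family with dummy set `T ⊇ T_U` (slopes matter modulo `P`,
  (Q) `phi7d_inst_congr_b`; offsets modulo `M = LQ`, (O) `phi7d_inst_congr`).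
* **`Shape.step9Needs_readout_attained_class`** — hence `classPOVM` + `classDec T` reads out the datum with
  weight EXACTLY `pairsCountT(Q,T)/Q^{2n}·⟨φ7.d|φ7.d⟩` on EVERY instance of `InClass U` (`T ⊇ T_U`), and
  **`Shape.step9Needs_readout_value_class`** packages it with (S): for `T = T_U` the two constants meet, so
  `pairsCountT(Q,T_U)/Q^{2n}` is THE minimax value on the class; **`…_prime`**: `= 1/Q + (1 − 1/Q)/Q^{#T_U}`
  for prime `Q`; **`Shape.blindGuess_lt_readout_attained_class`**: strictly above the blind-guess value `1/Q`
  of (S) `blindGuess_weight_eq_inst` on every instance.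

SCOPE (honest).  (a) Decided: the minimax value of the single-copy read-out problem for the Step-9 datum on
the WHOLE class `InClass U` is `pairsCountT(Q,T_U)/Q^{2n}` (`T_U = {t : t+1 ∈ U}`), attained by one
measurement on every instance; this CORRECTS the last sentence of (T) SCOPE (a).  For composite odd `Q` the
integer `pairsCountT` is not evaluated in closed form (only (S)'s estimate).  (b) `classPOVM` is a
mathematical POVM on the register of eq. (35)/§3.5.8 as formalised in `ChenQuantumLWESteps` /
`ChenQuantumLWEStepEight`, one run, one copy; no circuit or complexity statement is made or needed.
(c) Nothing here bears on LWE: the datum is read with probability `≈ 1/Q + 1/Q^{#T_U}` at best, Step 9 as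
printed needs it with certainty, and Part 1 (A)–(D) and the paper's own bug note (p. 37) stand; no repair and
no attack is suggested.  (d) No numerics enter any proof.

Everything is `sorry`-free over Mathlib and modules (A)–(T) of the bundle (imported, nothing re-proved).
-/

namespace Literature.Computability.Cryptography.Chen2024

open Matrix ComplexOrder

/-- Pointwise linear combinations of pairwise orthogonal families are orthogonal: if `u = Σᵢ aᵢ fᵢ` and
`w = Σₖ bₖ gₖ` pointwise and every `⟨fᵢ|gₖ⟩ = 0`, then `⟨u|w⟩ = 0`. [folklore] -/
theorem dotProduct_eq_zero_of_pointwise_sum {X ι κ : Type*} [Fintype X] [Fintype ι] [Fintype κ]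
    (u w : X → ℂ) (a : ι → ℂ) (b : κ → ℂ) (f : ι → X → ℂ) (g : κ → X → ℂ)
    (hu : ∀ z, u z = ∑ i, a i * f i z) (hw : ∀ z, w z = ∑ k, b k * g k z)
    (hfg : ∀ i k, star (f i) ⬝ᵥ g k = 0) : star u ⬝ᵥ w = 0 := by
  have hfg' : ∀ i k, ∑ z, (starRingEnd ℂ) (f i z) * g k z = 0 := fun i k => by
    simpa only [dotProduct, Pi.star_apply, Complex.star_def] using hfg i k
  have hz : ∀ z, (starRingEnd ℂ) (u z) * w z
      = ∑ i, ∑ k, ((starRingEnd ℂ) (a i) * b k) * ((starRingEnd ℂ) (f i z) * g k z) := by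
    intro z
    rw [hu z, hw z, map_sum, Finset.sum_mul]
    refine Finset.sum_congr rfl fun i _ => ?_
    rw [map_mul, Finset.mul_sum]
    exact Finset.sum_congr rfl fun k _ => by ring
  simp only [dotProduct, Pi.star_apply, Complex.star_def, hz]
  rw [Finset.sum_comm]
  refine Finset.sum_eq_zero fun i _ => ?_
  rw [Finset.sum_comm]
  refine Finset.sum_eq_zero fun k _ => ?_
  rw [← Finset.mul_sum, hfg' i k, mul_zero]

namespace Shape

variable (S : Shape)

/-! ### Frame vectors are combinations of states; frames of inequivalent offsets are orthogonal -/

/-- `σ_0(η) = 0`: with zero tail slopes the slope part of the head datum vanishes. [folklore] -/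
theorem sig_zero (η : Fin S.n → ZMod S.Q) : S.sig (fun _ => (0 : ℤ)) η = 0 := by
  simp [sig]

/-- Every head datum is `−2x` for some `x` (`Q` odd). [folklore] -/
theorem exists_eq_neg_two_mul (h : S.Admissible) (m : ZMod S.Q) : ∃ x : ZMod S.Q, m = -2 * x :=
  ⟨-(S.half * m), by linear_combination (-m) * S.two_mul_half h⟩

/-- **Fourier inversion of (R) `phi7_inst_expansion` (zero tail slopes):**
`w_{η,−2x}(z) = ψ_Q(p₁x²)·Σ_{y ∈ ℤ_Qⁿ} ψ_Q(⟨η,y⟩)·φ7(b⁰, v′ + L·(x,y))(z)` — every frame vector is a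
combination of `Qⁿ` STATES of the class (factored form). [cite: ChenQuantumLattice2024, eq. (35) p. 31, §3.5.8 p. 34] -/
theorem wv_neg_two_mul_apply' (η : Fin S.n → ZMod S.Q) (x : ZMod S.Q) (z : Fin (S.n + 1) → ZMod S.M) :
    S.wv η (-2 * x) z = ZMod.stdAddChar (((S.p₁ : ℕ) : ZMod S.Q) * x ^ 2)
      * ∑ y : Fin S.n → ZMod S.Q, ZMod.stdAddChar (∑ t, η t * y t)
          * (S.inst S.b0 (S.vOf (S.xyv x y))).phi7 z := by
  classical
  -- (R)'s expansion of each zero-slope state over the frame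
  have hexp : ∀ y : Fin S.n → ZMod S.Q, (S.inst S.b0 (S.vOf (S.xyv x y))).phi7 z
      = (1 / ((S.Q : ℕ) : ℂ) ^ S.n) * ∑ η' : Fin S.n → ZMod S.Q,
          ZMod.stdAddChar (-(∑ t, η' t * y t) - ((S.p₁ : ℕ) : ZMod S.Q) * x ^ 2) * S.wv η' (-2 * x) z := by
    intro y
    rw [S.phi7_inst_expansion (fun _ => (0 : ℤ)) S.b0_zero (fun t => by simp) x y z]
    simp only [sig_zero, mul_zero, sub_zero, add_zero]
  simp_rw [hexp]
  symm
  have hAA : ZMod.stdAddChar (((S.p₁ : ℕ) : ZMod S.Q) * x ^ 2)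
      * ZMod.stdAddChar (-(((S.p₁ : ℕ) : ZMod S.Q) * x ^ 2)) = 1 := by
    rw [← AddChar.map_add_eq_mul, add_neg_cancel, AddChar.map_zero_eq_one]
  have hQ : ((S.Q : ℕ) : ℂ) ^ S.n ≠ 0 := pow_ne_zero _ (by exact_mod_cast S.Q.ne_zero)
  -- each summand is one character value of `η − η′`
  have hfac : ∀ y η' : Fin S.n → ZMod S.Q,
      ZMod.stdAddChar (((S.p₁ : ℕ) : ZMod S.Q) * x ^ 2) * (ZMod.stdAddChar (∑ t, η t * y t)
        * ((1 / ((S.Q : ℕ) : ℂ) ^ S.n) * (ZMod.stdAddChar (-(∑ t, η' t * y t)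
          - ((S.p₁ : ℕ) : ZMod S.Q) * x ^ 2) * S.wv η' (-2 * x) z)))
      = (ZMod.stdAddChar (((S.p₁ : ℕ) : ZMod S.Q) * x ^ 2)
          * ZMod.stdAddChar (-(((S.p₁ : ℕ) : ZMod S.Q) * x ^ 2))) * (1 / ((S.Q : ℕ) : ℂ) ^ S.n)
          * S.wv η' (-2 * x) z * ZMod.stdAddChar (∑ t, (η - η') t * y t) := by
    intro y η'
    have hchar : ZMod.stdAddChar (∑ t, η t * y t)
        * ZMod.stdAddChar (-(∑ t, η' t * y t) - ((S.p₁ : ℕ) : ZMod S.Q) * x ^ 2)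
        = ZMod.stdAddChar (-(((S.p₁ : ℕ) : ZMod S.Q) * x ^ 2))
          * ZMod.stdAddChar (∑ t, (η - η') t * y t) := by
      rw [← AddChar.map_add_eq_mul, ← AddChar.map_add_eq_mul]
      congr 1
      simp only [Pi.sub_apply, sub_mul, Finset.sum_sub_distrib]
      ring
    calc _ = ZMod.stdAddChar (((S.p₁ : ℕ) : ZMod S.Q) * x ^ 2) * (1 / ((S.Q : ℕ) : ℂ) ^ S.n)
          * S.wv η' (-2 * x) z * (ZMod.stdAddChar (∑ t, η t * y t)
          * ZMod.stdAddChar (-(∑ t, η' t * y t) - ((S.p₁ : ℕ) : ZMod S.Q) * x ^ 2)) := by ring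
      _ = _ := by rw [hchar]; ring
  simp_rw [Finset.mul_sum, hfac]
  rw [Finset.sum_comm]
  simp_rw [← Finset.mul_sum, sum_stdAddChar_linForm]
  rw [Finset.sum_eq_single η (fun η' _ hne => by
      rw [if_neg (fun h0 => hne (sub_eq_zero.1 h0).symm), mul_zero])
    (fun hη => absurd (Finset.mem_univ η) hη),
    sub_self, if_pos rfl, hAA, one_mul, mul_right_comm, one_div, inv_mul_cancel₀ hQ, one_mul]

/-- **Every frame vector is a combination of `Qⁿ` states of the class** (pointwise, distributed form of
`wv_neg_two_mul_apply'`): `w_{η,−2x}(z) = Σ_y (ψ_Q(p₁x²)ψ_Q(⟨η,y⟩))·φ7(b⁰, v′ + L·(x,y))(z)`.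
[cite: ChenQuantumLattice2024, eq. (35) p. 31, §3.5.8 p. 34] -/
theorem wv_neg_two_mul_apply (η : Fin S.n → ZMod S.Q) (x : ZMod S.Q) (z : Fin (S.n + 1) → ZMod S.M) :
    S.wv η (-2 * x) z = ∑ y : Fin S.n → ZMod S.Q,
      (ZMod.stdAddChar (((S.p₁ : ℕ) : ZMod S.Q) * x ^ 2) * ZMod.stdAddChar (∑ t, η t * y t))
        * (S.inst S.b0 (S.vOf (S.xyv x y))).phi7 z := by
  rw [S.wv_neg_two_mul_apply', Finset.mul_sum]
  exact Finset.sum_congr rfl fun y _ => (mul_assoc _ _ _).symm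

/-- **Frames of inequivalent offsets are orthogonal.**  If `v ∈ Dℤⁿ⁺¹` is NOT congruent to `v′` modulo
`L = 2D²p₁` (coordinatewise; ANY integer offset `v`), then every frame vector of `S` is orthogonal to every
frame vector of the instance `(b, v)`: `⟨w_{η,m}|w^{(v)}_{η′,m′}⟩ = 0`.  (Both are combinations of equal-slope states whose offsets
are pairwise inequivalent modulo `M = LQ`, and those are orthogonal by (Q) `dot_phi7_sameB`.)
[cite: ChenQuantumLattice2024, eq. (35) p. 31, §3.5.8 pp. 33–34] -/
theorem star_wv_dotProduct_wv_inst (h : S.Admissible) {v : Fin (S.n + 1) → ℤ}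
    (hne : ¬ ∀ i, S.L ∣ v i - S.v' i)
    (η η' : Fin S.n → ZMod S.Q) (m m' : ZMod S.Q) :
    star (S.wv η m) ⬝ᵥ (S.inst S.b v).wv η' m' = 0 := by
  classical
  obtain ⟨x, rfl⟩ := S.exists_eq_neg_two_mul h m
  obtain ⟨x', rfl⟩ := S.exists_eq_neg_two_mul h m'
  refine dotProduct_eq_zero_of_pointwise_sum _ _ _ _
    (fun y => (S.inst S.b0 (S.vOf (S.xyv x y))).phi7)
    (fun y' => ((S.inst S.b v).inst (S.inst S.b v).b0 ((S.inst S.b v).vOf ((S.inst S.b v).xyv x' y'))).phi7)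
    (fun z => S.wv_neg_two_mul_apply η x z) (fun z => (S.inst S.b v).wv_neg_two_mul_apply η' x' z)
    fun y y' => ?_
  -- the two zero-slope states have offsets inequivalent modulo `M`
  have hy : (S.inst S.b0 (S.vOf (S.xyv x y))).Admissible := S.inst_b0_admissible h _
  have key := (S.inst S.b0 (S.vOf (S.xyv x y))).dot_phi7_sameB hy
    (fun i => v i + S.L * S.xyv x' y' i)
  split_ifs at key with hall
  · exfalso
    apply hne
    intro i
    have hi : ((S.M : ℕ) : ℤ) ∣ S.vOf (S.xyv x y) i - (v i + S.L * S.xyv x' y' i) :=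
      (ZMod.intCast_eq_intCast_iff_dvd_sub _ _ _).1 (hall i)
    rw [S.M_eq_L_mul_Q, vOf_apply] at hi
    have hL : S.L ∣ S.v' i + S.L * S.xyv x y i - (v i + S.L * S.xyv x' y' i) :=
      (dvd_mul_right _ _).trans hi
    have e : v i - S.v' i = -(S.v' i + S.L * S.xyv x y i - (v i + S.L * S.xyv x' y' i))
        + S.L * (S.xyv x y i - S.xyv x' y' i) := by ring
    rw [e]
    exact dvd_add (dvd_neg.2 hL) (dvd_mul_right _ _)
  · exact key

/-! ### The offset cosets and the union of all coset frames -/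

/-- The number of offset cosets per coordinate: `L/D = 2Dp₁`. [cite: ChenQuantumLattice2024, Cond. C.3 p. 18] -/
def cosetMod : ℕ+ := 2 * S.D * S.p₁

/-- `(2Dp₁ : ℤ) = 2·D·p₁`. [cite: ChenQuantumLattice2024, Cond. C.3 p. 18] -/
theorem cosetMod_coe : ((S.cosetMod : ℕ) : ℤ) = 2 * (S.D : ℤ) * S.p₁ := by
  show ((((2 * S.D * S.p₁ : ℕ+)) : ℕ) : ℤ) = _
  push_cast
  ring

/-- `L = D·(2Dp₁)`. [cite: ChenQuantumLattice2024, Cond. C.3 p. 18] -/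
theorem L_eq_D_mul_cosetMod : S.L = (S.D : ℤ) * ((S.cosetMod : ℕ) : ℤ) := by
  rw [cosetMod_coe, L]; ring

/-- The COSET LABELS `c ∈ ℤ_{2Dp₁}ⁿ⁺¹` of the offsets `v ∈ Dℤⁿ⁺¹` modulo `Lℤⁿ⁺¹`. [folklore] -/
abbrev Coset : Type := Fin (S.n + 1) → ZMod (S.cosetMod : ℕ)

/-- The representative offset `D·c ∈ Dℤⁿ⁺¹` of the coset `c`. [folklore] -/
def vrep (c : S.Coset) : Fin (S.n + 1) → ℤ := fun i => (S.D : ℤ) * ((c i).val : ℤ)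

/-- The base shape of coset `c`: slopes `b`, offset `D·c`. [cite: ChenQuantumLattice2024, §3.5.8 p. 34] -/
abbrev cshape (c : S.Coset) : Shape := S.inst S.b (S.vrep c)

/-- The base shape of every coset is admissible (`D ∣ D·c`). [cite: ChenQuantumLattice2024, Cond. C.3 p. 18] -/
theorem cshape_admissible (h : S.Admissible) (c : S.Coset) : (S.cshape c).Admissible :=
  S.inst_admissible h h.b_head h.b_tail fun _ => dvd_mul_right _ _

/-- Different coset labels are inequivalent offsets modulo `L`. [folklore] -/
theorem vrep_sub_not_dvd {c c' : S.Coset} (hne : c ≠ c') : ¬ ∀ i, S.L ∣ S.vrep c' i - S.vrep c i := by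
  intro hall
  apply hne
  funext i
  have hD : (S.D : ℤ) ≠ 0 := by exact_mod_cast S.D.ne_zero
  have h1 : (S.D : ℤ) * ((S.cosetMod : ℕ) : ℤ) ∣ (S.D : ℤ) * (((c' i).val : ℤ) - ((c i).val : ℤ)) := by
    have e : S.vrep c' i - S.vrep c i = (S.D : ℤ) * (((c' i).val : ℤ) - ((c i).val : ℤ)) := by
      simp only [vrep]; ring
    rw [← L_eq_D_mul_cosetMod, ← e]
    exact hall i
  have h2 : ((S.cosetMod : ℕ) : ℤ) ∣ ((c' i).val : ℤ) - ((c i).val : ℤ) := (mul_dvd_mul_iff_left hD).1 h1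
  have h3 := (ZMod.intCast_eq_intCast_iff_dvd_sub ((c i).val : ℤ) ((c' i).val : ℤ) (S.cosetMod : ℕ)).2 h2
  rwa [Int.cast_natCast, Int.cast_natCast, ZMod.natCast_zmod_val, ZMod.natCast_zmod_val] at h3

/-- The index set of the union of all coset frames: `ℤ_{2Dp₁}ⁿ⁺¹ × (ℤ_Qⁿ × ℤ_Q)`. [folklore] -/
abbrev BigIdx : Type := S.Coset × S.FrameIdx

/-- **THE CLASS FRAME**: `W_{c,η,m} := T w^{(c)}_{η,m}`, the transformed frame vector `(η, m)` of the base
shape of coset `c` ((T) `frameVec`). [cite: ChenQuantumLattice2024, §3.5.8 p. 33] -/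
noncomputable def bigFrameVec (a : S.BigIdx) : Ket (S.n + 1) S.M := (S.cshape a.1).frameVec a.2

/-- **The class frame is orthogonal with common squared norm `ν`:** `⟨W_a|W_{a′}⟩ = ν·[a = a′]` — within a
coset this is (T) `frame_orth`; across cosets the untransformed frames are orthogonal
(`star_wv_dotProduct_wv_inst`, `vrep_sub_not_dvd`) and `T` scales inner products of `Dℤⁿ⁺¹`-supported kets
((R) `dotProduct_step8Map`, `wv_support_D`). [cite: ChenQuantumLattice2024, §3.5.8 pp. 33–34] -/
theorem bigFrame_orth (h : S.Admissible) (a a' : S.BigIdx) :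
    star (S.bigFrameVec a) ⬝ᵥ S.bigFrameVec a' = if a = a' then ((S.frameNormSq : ℝ) : ℂ) else 0 := by
  obtain ⟨c, j⟩ := a
  obtain ⟨c', j'⟩ := a'
  unfold bigFrameVec
  dsimp only
  by_cases hc : c = c'
  · subst hc
    have key := (S.cshape c).frame_orth (S.cshape_admissible h c) j j'
    by_cases hj : j = j'
    · subst hj
      rw [if_pos rfl]
      rw [if_pos rfl] at key
      exact key
    · rw [if_neg fun h2 => hj (Prod.mk.inj h2).2]
      rw [if_neg hj] at key
      exact key
  · rw [if_neg fun h2 => hc (Prod.mk.inj h2).1]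
    show star (S.step8Map ((S.cshape c).wv j.1 j.2)) ⬝ᵥ S.step8Map ((S.cshape c').wv j'.1 j'.2) = 0
    rw [S.dotProduct_step8Map ((S.cshape c).wv j.1 j.2) ((S.cshape c').wv j'.1 j'.2)
      fun z hz => (S.cshape c').wv_support_D (S.cshape_admissible h c') hz]
    have key := (S.cshape c).star_wv_dotProduct_wv_inst (S.cshape_admissible h c) (v := S.vrep c')
      (S.vrep_sub_not_dvd hc) j.1 j'.1 j.2 j'.2
    exact mul_eq_zero_of_right _ key

/-- **THE CLASS MEASUREMENT** of the Step-8 register (outcomes `(some (c,η,m) | none, β′)`): the frame POVM of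
the class frame ((T) `POVM.ofFrame`) followed by a uniformly random dummy guess `β′ ∈ ℤ_Qⁿ`
((S) `POVM.withCoin`). [cite: NielsenChuang2010, §2.2.6 p. 90] -/
noncomputable def classPOVM (h : S.Admissible) :
    POVM (Fin (S.n + 1) → ZMod S.M) (Option S.BigIdx × (Fin S.n → ZMod S.Q)) :=
  (POVM.ofFrame S.bigFrameVec S.frameNormSq_pos (S.bigFrame_orth h)).withCoin (Fin S.n → ZMod S.Q)

/-- **THE CLASS DECODER**: on outcome `(some (c, η, m), β′)` decode with (T) `frameDec` of the base shape of
coset `c` (answer `D·c₀ + L·x̂ (mod D²P)`); on `(none, β′)` answer anything. [folklore] -/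
noncomputable def classDec (T : Finset (Fin S.n)) : Option S.BigIdx × (Fin S.n → ZMod S.Q) → ZMod S.N
  | (none, _) => 0
  | (some a, β') => (S.cshape a.1).frameDec T (some a.2, β')

/-! ### The members of the coset families under the class measurement -/

/-- The member `(β, x, ȳ)` of the dummy family of coset `c`: slopes `famBT T β`, offset `D·c + L·(x, ȳ)`
(the family `F_T` of (S)/(T) for the base shape `cshape c`). [cite: ChenQuantumLattice2024, §3.1 p. 22, §3.5.8 p. 34] -/
abbrev cmember (T : Finset (Fin S.n)) (c : S.Coset) (β : Fin S.n → ZMod S.Q) (x : ZMod S.Q)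
    (yb : Fin S.n → ZMod S.Q) : Shape :=
  (S.cshape c).inst ((S.cshape c).famBT T β) ((S.cshape c).vOf ((S.cshape c).xyv x yb))

/-- A member of coset `c` is orthogonal to the frame vectors of every other coset. [folklore] -/
theorem bigFrameVec_dotProduct_cmember_ne (h : S.Admissible) (T : Finset (Fin S.n)) (β : Fin S.n → ZMod S.Q)
    (x : ZMod S.Q) (yb : Fin S.n → ZMod S.Q) {c c' : S.Coset} (hc : c' ≠ c) (j : S.FrameIdx) :
    star (S.bigFrameVec (c', j)) ⬝ᵥ (S.cmember T c β x yb).phi7d = 0 := by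
  have hφ : (S.cmember T c β x yb).phi7d = ∑ η : Fin S.n → ZMod S.Q,
      (S.cshape c).coefOf T β x yb η • S.bigFrameVec (c, (η, (S.cshape c).mOf T β x η)) := by
    funext p
    rw [Finset.sum_apply]
    simp_rw [Pi.smul_apply, smul_eq_mul]
    exact (S.cshape c).phi7d_member_apply T β x yb p
  rw [hφ, dotProduct_sum]
  refine Finset.sum_eq_zero fun η _ => ?_
  rw [dotProduct_smul, S.bigFrame_orth h, if_neg fun h2 => hc (Prod.mk.inj h2).1, smul_zero]

/-- Weight of outcome `some (c′, η′, m′)` of the class frame POVM on the member `(β, x, ȳ)` of coset `c`: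
`ν/Q^{2n}·[c′ = c]·[m′ = m_{β,x}(η′)]` ((T) `frame_weight_some_re` within the coset, `0` across).
[cite: NielsenChuang2010, §2.2.6 p. 90] -/
theorem class_weight_some_re (h : S.Admissible) (T : Finset (Fin S.n)) (c : S.Coset)
    (β : Fin S.n → ZMod S.Q) (x : ZMod S.Q) (yb : Fin S.n → ZMod S.Q) (a : S.BigIdx) :
    ((POVM.ofFrame S.bigFrameVec S.frameNormSq_pos (S.bigFrame_orth h)).weight
        (S.cmember T c β x yb).phi7d (some a)).re
      = if a.1 = c ∧ a.2.2 = (S.cshape c).mOf T β x a.2.1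
          then S.frameNormSq / ((S.Q : ℕ) : ℝ) ^ (2 * S.n) else 0 := by
  obtain ⟨c', j⟩ := a
  rw [POVM.ofFrame_weight_some, Complex.ofReal_re]
  dsimp only
  by_cases hc : c' = c
  · have key := (S.cshape c).frame_weight_some_re (S.cshape_admissible h c) T β x yb j
    rw [POVM.ofFrame_weight_some, Complex.ofReal_re] at key
    simp only [hc, true_and]
    exact key
  · rw [if_neg fun h2 => hc h2.1, S.bigFrameVec_dotProduct_cmember_ne h T β x yb hc j, norm_zero,
      zero_pow two_ne_zero, mul_zero]

/-- Weight of outcome `none` of the class frame POVM on every member of every coset family is `0` (members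
lie in the span of their own coset frame, (T) `frame_weight_none_re`). [cite: NielsenChuang2010, §2.2.6 p. 90] -/
theorem class_weight_none_re (h : S.Admissible) (T : Finset (Fin S.n)) (c : S.Coset)
    (β : Fin S.n → ZMod S.Q) (x : ZMod S.Q) (yb : Fin S.n → ZMod S.Q) :
    ((POVM.ofFrame S.bigFrameVec S.frameNormSq_pos (S.bigFrame_orth h)).weight
        (S.cmember T c β x yb).phi7d none).re = 0 := by
  rw [POVM.ofFrame_weight_none_re, Fintype.sum_prod_type, Finset.sum_eq_single c (fun c' _ hc =>
      Finset.sum_eq_zero fun j _ => by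
        rw [S.bigFrameVec_dotProduct_cmember_ne h T β x yb hc j, norm_zero, zero_pow two_ne_zero, mul_zero])
    (fun hc => absurd (Finset.mem_univ c) hc)]
  have key := (S.cshape c).frame_weight_none_re (S.cshape_admissible h c) T β x yb
  rw [POVM.ofFrame_weight_none_re] at key
  exact key

/-- **EXACT SUCCESS WEIGHT ON EVERY MEMBER OF EVERY COSET FAMILY:** the class measurement `classPOVM` with
the decoder `classDec T` reads out the Step-9 datum of the member `(β, x, ȳ)` of coset `c` with weight
EXACTLY `pairsCountT(Q,T)/Q^{2n}·⟨φ7.d|φ7.d⟩` (within the coset this is (T) `step9Needs_readout_attained`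
for the base shape `cshape c`; the other cosets' outcomes have weight `0`).
[cite: ChenQuantumLattice2024, §3.5.8 pp. 33–34, §3.5.9 p. 37; NielsenChuang2010, §2.2.6 p. 90] -/
theorem step9Needs_readout_attained_cmember (h : S.Admissible) (T : Finset (Fin S.n)) (c : S.Coset)
    (β : Fin S.n → ZMod S.Q) (x : ZMod S.Q) (yb : Fin S.n → ZMod S.Q) :
    ∑ k ∈ Finset.univ.filter (fun k => S.classDec T k = (S.cmember T c β x yb).step9Needs),
        ((S.classPOVM h).weight (S.cmember T c β x yb).phi7d k).re
      = (pairsCountT (S.Q : ℕ) T : ℝ) / ((S.Q : ℕ) : ℝ) ^ (2 * S.n)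
          * (star (S.cmember T c β x yb).phi7d ⬝ᵥ (S.cmember T c β x yb).phi7d).re := by
  classical
  set N₉ : ZMod S.N := (S.cmember T c β x yb).step9Needs with hN₉
  have hcard : (Fintype.card (Fin S.n → ZMod S.Q) : ℝ) = ((S.Q : ℕ) : ℝ) ^ S.n := by
    rw [Fintype.card_pi, Finset.prod_const, ZMod.card, Finset.card_univ, Fintype.card_fin]
    push_cast
    rfl
  -- the count and the norm, read through the base shape of the coset
  have hcount : (Finset.univ.filter fun q : S.FrameIdx × (Fin S.n → ZMod S.Q) =>
      S.classDec T (some (c, q.1), q.2) = N₉ ∧ q.1.2 = (S.cshape c).mOf T β x q.1.1).card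
        = pairsCountT (S.Q : ℕ) T :=
    (S.cshape c).card_correct_eq_pairsCountT (S.cshape_admissible h c) T β x yb
  have hnorm : (star (S.cmember T c β x yb).phi7d ⬝ᵥ (S.cmember T c β x yb).phi7d).re
      = S.frameNormSq / ((S.Q : ℕ) : ℝ) ^ S.n :=
    (S.cshape c).star_phi7d_member (S.cshape_admissible h c) T β x yb
  rw [Finset.sum_filter, Fintype.sum_prod_type, Fintype.sum_option]
  simp only [classPOVM, POVM.withCoin_weight_re, S.class_weight_none_re h, S.class_weight_some_re h,
    mul_zero, ite_self, Finset.sum_const_zero, zero_add, hcard]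
  -- only the outcomes of coset `c` score
  rw [Fintype.sum_prod_type, Finset.sum_eq_single c (fun c' _ hc => by
      simp only [hc, false_and, if_false, mul_zero, ite_self, Finset.sum_const_zero])
    (fun hc => absurd (Finset.mem_univ c) hc)]
  simp only [true_and]
  -- collect the two conditions
  have hite : ∀ (j : S.FrameIdx) (β' : Fin S.n → ZMod S.Q),
      (if S.classDec T (some (c, j), β') = N₉ then
          (((S.Q : ℕ) : ℝ) ^ S.n)⁻¹ * (if j.2 = (S.cshape c).mOf T β x j.1 then
            S.frameNormSq / ((S.Q : ℕ) : ℝ) ^ (2 * S.n) else 0) else 0)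
        = if S.classDec T (some (c, j), β') = N₉ ∧ j.2 = (S.cshape c).mOf T β x j.1 then
            (((S.Q : ℕ) : ℝ) ^ S.n)⁻¹ * (S.frameNormSq / ((S.Q : ℕ) : ℝ) ^ (2 * S.n)) else 0 := by
    intro j β'
    split_ifs <;> simp_all
  simp_rw [hite]
  rw [← Fintype.sum_prod_type' (f := fun (j : S.FrameIdx) (β' : Fin S.n → ZMod S.Q) =>
      if S.classDec T (some (c, j), β') = N₉ ∧ j.2 = (S.cshape c).mOf T β x j.1 then
        (((S.Q : ℕ) : ℝ) ^ S.n)⁻¹ * (S.frameNormSq / ((S.Q : ℕ) : ℝ) ^ (2 * S.n)) else 0),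
    ← Finset.sum_filter, Finset.sum_const, hcount, nsmul_eq_mul, hnorm]
  have hQ : ((S.Q : ℕ) : ℝ) ≠ 0 := by exact_mod_cast S.Q.ne_zero
  field_simp

/-! ### Every instance of the class is a member of a coset family -/

/-- The coset label of an offset `v ∈ Dℤⁿ⁺¹`: `c_i := v_i/D mod 2Dp₁`. [folklore] -/
def cosetOf (v : Fin (S.n + 1) → ℤ) : S.Coset := fun i => (((v i / (S.D : ℤ) : ℤ)) : ZMod (S.cosetMod : ℕ))

/-- The `L`-quotient of an offset `v ∈ Dℤⁿ⁺¹`: `q_i := ⌊(v_i/D)/(2Dp₁)⌋`. [folklore] -/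
def quotOf (v : Fin (S.n + 1) → ℤ) : Fin (S.n + 1) → ℤ := fun i => (v i / (S.D : ℤ)) / ((S.cosetMod : ℕ) : ℤ)

/-- `v = D·c(v) + L·q(v)` for `v ∈ Dℤⁿ⁺¹`. [folklore] -/
theorem vrep_cosetOf_add {v : Fin (S.n + 1) → ℤ} (hv : ∀ i, (S.D : ℤ) ∣ v i) (i : Fin (S.n + 1)) :
    S.vrep (S.cosetOf v) i + S.L * S.quotOf v i = v i := by
  have hval : (((S.cosetOf v i).val : ℕ) : ℤ) = (v i / (S.D : ℤ)) % ((S.cosetMod : ℕ) : ℤ) :=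
    ZMod.val_intCast _
  have hsplit := Int.mul_ediv_add_emod (v i / (S.D : ℤ)) ((S.cosetMod : ℕ) : ℤ)
  have hw : (S.D : ℤ) * (v i / (S.D : ℤ)) = v i := Int.mul_ediv_cancel' (hv i)
  show (S.D : ℤ) * (((S.cosetOf v i).val : ℕ) : ℤ) + S.L * ((v i / (S.D : ℤ)) / ((S.cosetMod : ℕ) : ℤ)) = v i
  rw [hval, L_eq_D_mul_cosetMod]
  linear_combination (S.D : ℤ) * hsplit + hw

/-- **EVERY INSTANCE OF THE CLASS IS A MEMBER OF A COSET FAMILY** (same `|φ7.d⟩`, same Step-9 datum): if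
`T ⊇ T_U = {t : t+1 ∈ U}` then for every `(b₂, v₂) ∈ InClass U` there are a coset `c`, dummies `β` and
residues `(x, ȳ)` with `|φ7.d(b₂,v₂)⟩ = |φ7.d⟩` of the member `(β, x, ȳ)` of coset `c` and the same datum
`v₂,₀ ≡ D·c₀ + L·x (mod D²P)` — slopes matter only modulo `P` ((Q) `phi7d_inst_congr_b`: off `U` they are
the true ones, on `T` the dummy absorbs `b₂,_{t+1}/(2p₁) mod Q`), offsets only modulo `M = LQ`
((O) `phi7d_inst_congr`). [cite: ChenQuantumLattice2024, Cond. C.3 p. 18, eq. (35) p. 31, §3.5.9 p. 37] -/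
theorem exists_cmember_of_inClass (h : S.Admissible) {U : Finset (Fin (S.n + 1))} {T : Finset (Fin S.n)}
    (hT : ∀ t : Fin S.n, t.succ ∈ U → t ∈ T) {b₂ v₂ : Fin (S.n + 1) → ℤ} (hI : S.InClass U b₂ v₂) :
    ∃ (c : S.Coset) (β : Fin S.n → ZMod S.Q) (x : ZMod S.Q) (yb : Fin S.n → ZMod S.Q),
      (S.inst b₂ v₂).phi7d = (S.cmember T c β x yb).phi7d ∧
        (S.inst b₂ v₂).step9Needs = (S.cmember T c β x yb).step9Needs := by
  obtain ⟨hoff, hA⟩ := hI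
  have hb0 : b₂ 0 = -1 := hA.b_head
  have hbt : ∀ i : Fin (S.n + 1), i ≠ 0 → 2 * (S.p₁ : ℤ) ∣ b₂ i := hA.b_tail
  have hvD : ∀ i, (S.D : ℤ) ∣ v₂ i := hA.v'_in_DZ
  set c : S.Coset := S.cosetOf v₂ with hc
  set q : Fin (S.n + 1) → ℤ := S.quotOf v₂ with hq
  set β : Fin S.n → ZMod S.Q :=
    fun t => (((b₂ t.succ / (2 * (S.p₁ : ℤ)) - S.b t.succ / (2 * (S.p₁ : ℤ)) : ℤ)) : ZMod S.Q) with hβ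
  set x : ZMod S.Q := ((q 0 : ℤ) : ZMod S.Q) with hx
  set yb : Fin S.n → ZMod S.Q := fun t => ((q t.succ : ℤ) : ZMod S.Q) with hyb
  -- the slopes agree modulo `P`
  have hsucc : ∀ t : Fin S.n, (S.cshape c).famBT T β t.succ
      = 2 * (S.p₁ : ℤ) * (S.b t.succ / (2 * (S.p₁ : ℤ)) + if t ∈ T then ((β t).val : ℤ) else 0) :=
    fun t => (S.cshape c).famBT_succ T β t
  have hb : ∀ i, ((S.P : ℕ) : ℤ) ∣ b₂ i - (S.cshape c).famBT T β i := by
    intro i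
    refine Fin.cases ?_ (fun t => ?_) i
    · rw [hb0, famBT_zero, sub_self]
      exact dvd_zero _
    · rw [hsucc t, S.P_coe]
      by_cases ht : t ∈ T
      · rw [if_pos ht]
        have hB₂ : 2 * (S.p₁ : ℤ) * (b₂ t.succ / (2 * (S.p₁ : ℤ))) = b₂ t.succ :=
          Int.mul_ediv_cancel' (hbt t.succ (Fin.succ_ne_zero t))
        have hβt : (((β t).val : ℕ) : ℤ)
            = (b₂ t.succ / (2 * (S.p₁ : ℤ)) - S.b t.succ / (2 * (S.p₁ : ℤ))) % ((S.Q : ℕ) : ℤ) :=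
          ZMod.val_intCast _
        have hsplitQ := Int.mul_ediv_add_emod (b₂ t.succ / (2 * (S.p₁ : ℤ)) - S.b t.succ / (2 * (S.p₁ : ℤ)))
          ((S.Q : ℕ) : ℤ)
        rw [hβt]
        exact ⟨2 * ((b₂ t.succ / (2 * (S.p₁ : ℤ)) - S.b t.succ / (2 * (S.p₁ : ℤ))) / ((S.Q : ℕ) : ℤ)),
          by linear_combination (-1 : ℤ) * hB₂ + (-2 * (S.p₁ : ℤ)) * hsplitQ⟩
      · have hU : t.succ ∉ U := fun hu => ht (hT t hu)
        have hB : 2 * (S.p₁ : ℤ) * (S.b t.succ / (2 * (S.p₁ : ℤ))) = S.b t.succ :=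
          Int.mul_ediv_cancel' (h.b_tail t.succ (Fin.succ_ne_zero t))
        rw [if_neg ht, add_zero, hoff t.succ hU, hB, sub_self]
        exact dvd_zero _
  -- the offsets agree modulo `M`
  have hq' : ∀ i, S.vrep c i + S.L * q i = v₂ i := fun i => S.vrep_cosetOf_add hvD i
  have hr : ∀ i, ((S.cshape c).xyv x yb i : ℤ) = q i % ((S.Q : ℕ) : ℤ) := by
    intro i
    refine Fin.cases ?_ (fun t => ?_) i
    · rw [xyv_zero]; exact ZMod.val_intCast _
    · rw [xyv_succ]; exact ZMod.val_intCast _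
  have hv : ∀ i, ((v₂ i : ℤ) : ZMod S.M)
      = ((((S.cshape c).vOf ((S.cshape c).xyv x yb) i : ℤ)) : ZMod S.M) := by
    intro i
    rw [ZMod.intCast_eq_intCast_iff_dvd_sub, vOf_apply, S.M_eq_L_mul_Q]
    show S.L * ((S.Q : ℕ) : ℤ) ∣ S.vrep c i + S.L * (S.cshape c).xyv x yb i - v₂ i
    rw [hr i]
    have hsq := Int.mul_ediv_add_emod (q i) ((S.Q : ℕ) : ℤ)
    exact ⟨-(q i / ((S.Q : ℕ) : ℤ)), by linear_combination hq' i + S.L * hsq⟩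
  refine ⟨c, β, x, yb, ?_, ?_⟩
  · exact (S.phi7d_inst_congr_b v₂ hb).trans
      (phi7d_inst_congr (S := S) ((S.cshape c).famBT T β) ((S.cshape c).vOf ((S.cshape c).xyv x yb)) v₂ hv)
  · show ((v₂ 0 : ℤ) : ZMod S.N) = ((((S.cshape c).vOf ((S.cshape c).xyv x yb) 0 : ℤ)) : ZMod S.N)
    have hM : ((S.M : ℕ) : ℤ) ∣ (S.cshape c).vOf ((S.cshape c).xyv x yb) 0 - v₂ 0 :=
      (ZMod.intCast_eq_intCast_iff_dvd_sub _ _ _).1 (hv 0)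
    have hNM : ((S.N : ℕ) : ℤ) ∣ ((S.M : ℕ) : ℤ) := ⟨2, by rw [S.M_coe, S.N_coe]; ring⟩
    exact (ZMod.intCast_eq_intCast_iff_dvd_sub _ _ _).2 (hNM.trans hM)

/-! ### The value of the read-out problem on the whole class -/

/-- **READ-OUT BOUND ATTAINED ON THE WHOLE CLASS.**  For EVERY admissible shape, every set `U` of unknown
slope coordinates, every dummy set `T ⊇ T_U = {t : t+1 ∈ U}` and EVERY instance `(b₂, v₂) ∈ InClass U`
(ANY secret/error on `U`, ANY admissible offset `v₂ ∈ Dℤⁿ⁺¹`), the ONE class measurement `classPOVM` with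
the decoder `classDec T` outputs the Step-9 datum `v₂,₀ mod D²P` with weight EXACTLY
`pairsCountT(Q,T)/Q^{2n}·⟨φ7.d|φ7.d⟩`.  With (S) `step9Needs_readout_le_dummies` (`T = T_U`) this constant
is therefore THE minimax value of the single-copy read-out problem on the class (packaged below).  Value: a
kernel-checked THEOREM about the withdrawn algorithm — not summit progress, no cryptanalytic claim.
[cite: ChenQuantumLattice2024, §3.5.8 pp. 33–34, §3.5.9 p. 37; NielsenChuang2010, §2.2.6 p. 90] -/
theorem step9Needs_readout_attained_class (h : S.Admissible) {U : Finset (Fin (S.n + 1))}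
    {T : Finset (Fin S.n)} (hT : ∀ t : Fin S.n, t.succ ∈ U → t ∈ T) {b₂ v₂ : Fin (S.n + 1) → ℤ}
    (hI : S.InClass U b₂ v₂) :
    ∑ k ∈ Finset.univ.filter (fun k => S.classDec T k = (S.inst b₂ v₂).step9Needs),
        ((S.classPOVM h).weight (S.inst b₂ v₂).phi7d k).re
      = (pairsCountT (S.Q : ℕ) T : ℝ) / ((S.Q : ℕ) : ℝ) ^ (2 * S.n)
          * (star (S.inst b₂ v₂).phi7d ⬝ᵥ (S.inst b₂ v₂).phi7d).re := by
  obtain ⟨c, β, x, yb, hφ, hN⟩ := S.exists_cmember_of_inClass h hT hI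
  rw [hφ, hN]
  exact S.step9Needs_readout_attained_cmember h T c β x yb

/-- **THE CLASS MEASUREMENT STRICTLY BEATS BLIND GUESSING ON EVERY INSTANCE OF THE CLASS:** its success weight
`pairsCountT(Q,T)/Q^{2n}·⟨φ7.d|φ7.d⟩` exceeds the blind-guess weight `⟨φ7.d|φ7.d⟩/Q` of (S)
`blindGuess_weight_eq_inst` (exact on every admissible instance). [cite: NielsenChuang2010, §2.2.6 p. 90] -/
theorem blindGuess_lt_readout_attained_class (h : S.Admissible) {U : Finset (Fin (S.n + 1))}
    {T : Finset (Fin S.n)} (hT : ∀ t : Fin S.n, t.succ ∈ U → t ∈ T) {b₂ v₂ : Fin (S.n + 1) → ℤ}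
    (hI : S.InClass U b₂ v₂) :
    (1 / ((S.Q : ℕ) : ℝ)) * (star (S.inst b₂ v₂).phi7d ⬝ᵥ (S.inst b₂ v₂).phi7d).re
      < ∑ k ∈ Finset.univ.filter (fun k => S.classDec T k = (S.inst b₂ v₂).step9Needs),
          ((S.classPOVM h).weight (S.inst b₂ v₂).phi7d k).re := by
  rw [S.step9Needs_readout_attained_class h hT hI]
  have hn0 : 0 < (star (S.inst b₂ v₂).phi7d ⬝ᵥ (S.inst b₂ v₂).phi7d).re := by
    rw [S.star_phi7d_dotProduct_phi7d_inst hI.2, show (((S.M : ℕ) : ℂ) * (S.D : ℕ)) ^ (S.n + 1)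
        * (((S.P : ℕ) : ℂ) * 2 ^ S.n) = (((((S.M : ℕ) : ℝ) * (S.D : ℕ)) ^ (S.n + 1)
        * (((S.P : ℕ) : ℝ) * 2 ^ S.n) : ℝ) : ℂ) by push_cast; ring, Complex.ofReal_re]
    have hM : (0 : ℝ) < (S.M : ℕ) := by exact_mod_cast S.M.pos
    have hD : (0 : ℝ) < (S.D : ℕ) := by exact_mod_cast S.D.pos
    have hP : (0 : ℝ) < (S.P : ℕ) := by exact_mod_cast S.P.pos
    positivity
  exact mul_lt_mul_of_pos_right (inv_lt_pairsCountT_div h.odd_Q (by have := h.three_le_Q; omega) T) hn0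

/-- The unknown TAIL coordinates of `U`: `T_U := {t : t+1 ∈ U}`. [folklore] -/
def tailSet (U : Finset (Fin (S.n + 1))) : Finset (Fin S.n) := Finset.univ.filter fun t => t.succ ∈ U

/-- `t ∈ T_U ↔ t+1 ∈ U`. [folklore] -/
theorem mem_tailSet (U : Finset (Fin (S.n + 1))) (t : Fin S.n) : t ∈ S.tailSet U ↔ t.succ ∈ U := by
  simp [tailSet]

/-- **THE VALUE OF THE SINGLE-COPY READ-OUT PROBLEM ON THE WHOLE CLASS (both sides, packaged).**  For every
set `U` of unknown slope coordinates, with `T_U = {t : t+1 ∈ U}`: (i) ((S), imported) for EVERY POVM `E`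
and EVERY decoder `dec` some instance of `InClass U` has success weight
`≤ pairsCountT(Q,T_U)/Q^{2n}·⟨φ7.d|φ7.d⟩`; (ii) (this file) the class measurement `classPOVM` with
`classDec T_U` succeeds on EVERY instance of `InClass U` with weight EXACTLY that bound.  So
`pairsCountT(Q,T_U)/Q^{2n}` is the minimax value — over all measurements and decoders, against all instances
of the class — of reading the Step-9 datum `v′₀ mod D²P` out of one copy of the Step-8 register; it lies
strictly between the blind-guess value `1/Q` and `1`.  A theorem about a WITHDRAWN algorithm's Step 8/9
interface; nothing about LWE. [cite: ChenQuantumLattice2024, §3.5.8 pp. 33–34, §3.5.9 p. 37; NielsenChuang2010, §2.2.6 p. 90] -/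
theorem step9Needs_readout_value_class (h : S.Admissible) (U : Finset (Fin (S.n + 1))) :
    (∀ {κ : Type*} [Fintype κ] [DecidableEq κ] (E : POVM (Fin (S.n + 1) → ZMod S.M) κ) (dec : κ → ZMod S.N),
      ∃ b₂ v₂ : Fin (S.n + 1) → ℤ, S.InClass U b₂ v₂ ∧
        (∑ k ∈ Finset.univ.filter (fun k => dec k = (S.inst b₂ v₂).step9Needs),
            (E.weight (S.inst b₂ v₂).phi7d k).re)
          ≤ (pairsCountT (S.Q : ℕ) (S.tailSet U) : ℝ) / ((S.Q : ℕ) : ℝ) ^ (2 * S.n)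
              * (star (S.inst b₂ v₂).phi7d ⬝ᵥ (S.inst b₂ v₂).phi7d).re) ∧
    (∀ b₂ v₂ : Fin (S.n + 1) → ℤ, S.InClass U b₂ v₂ →
      ∑ k ∈ Finset.univ.filter (fun k => S.classDec (S.tailSet U) k = (S.inst b₂ v₂).step9Needs),
          ((S.classPOVM h).weight (S.inst b₂ v₂).phi7d k).re
        = (pairsCountT (S.Q : ℕ) (S.tailSet U) : ℝ) / ((S.Q : ℕ) : ℝ) ^ (2 * S.n)
            * (star (S.inst b₂ v₂).phi7d ⬝ᵥ (S.inst b₂ v₂).phi7d).re) :=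
  ⟨fun E dec => S.step9Needs_readout_le_dummies h (S.tailSet U) (fun t ht => (S.mem_tailSet U t).1 ht) E dec,
    fun _ _ hI => S.step9Needs_readout_attained_class h (fun t ht => (S.mem_tailSet U t).2 ht) hI⟩

/-- **PRIME `Q`: THE CLASS VALUE IN CLOSED FORM.**  For prime `Q` the minimax value of the single-copy
read-out problem on `InClass U` is EXACTLY `1/Q + (1 − 1/Q)/Q^{#T_U}` ((T) `pairsCountT_div_eq_prime`): the
upper bound of (S) `step9Needs_readout_le_dummies_prime` is attained on every instance of the class by the
class measurement.  (With `#T_U ≥ 1` unknown tail slope this is `< 2/Q`; Step 9 as printed needs the datum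
with certainty — the paper's bug note, p. 37, stands; nothing about LWE.)
[cite: ChenQuantumLattice2024, §3.5.8 pp. 33–34, §3.5.9 p. 37; NielsenChuang2010, §2.2.6 p. 90] -/
theorem step9Needs_readout_attained_class_prime (h : S.Admissible) (hQ : (S.Q : ℕ).Prime)
    {U : Finset (Fin (S.n + 1))} {b₂ v₂ : Fin (S.n + 1) → ℤ} (hI : S.InClass U b₂ v₂) :
    ∑ k ∈ Finset.univ.filter (fun k => S.classDec (S.tailSet U) k = (S.inst b₂ v₂).step9Needs),
        ((S.classPOVM h).weight (S.inst b₂ v₂).phi7d k).re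
      = (1 / ((S.Q : ℕ) : ℝ) + (1 - 1 / ((S.Q : ℕ) : ℝ)) * (1 / ((S.Q : ℕ) : ℝ) ^ (S.tailSet U).card))
          * (star (S.inst b₂ v₂).phi7d ⬝ᵥ (S.inst b₂ v₂).phi7d).re := by
  rw [S.step9Needs_readout_attained_class h (fun t ht => (S.mem_tailSet U t).2 ht) hI,
    pairsCountT_div_eq_prime hQ h.odd_Q (S.tailSet U)]

end Shape

end Literature.Computability.Cryptography.Chen2024
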